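import Mathlib

/-!
# T5TensorSeparation — kernel witness for route/T5-CHECK-N3-p8.md v3 §7, row N3.10.3 (blind cell pub-hodge-repro2)

The first step of the «at most one partner» reading of Mœglin–Vignéras–Waldspurger, LNM 1291,
Ch. 5 Théorème I.6 (re-derived in CHECK-N3 v3 §7 from chap. 2 III.5): a non-zero
H̃₁ × H̃₂-map Φ : S → V₁ ⊗ V₂ kills S(π₁) := ⋂_{f ∈ Hom_{H̃₁}(S, V₁)} Ker f, because composing Φ
with the functionals of V₂ produces H̃₁-maps S → V₁ (MVW chap. 2 III.5, p0048 ll. 1–5).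

Kernel form. `k` is the coefficient field, `S` a `k`-algebra (the group algebra of H̃₁ in the
prose), `M` an `S`-module (V₁) and `N` a `k`-vector space (V₂) on which `S` does not act; the
tensor product `M ⊗[k] N` carries the `S`-action through `M` (Mathlib's `TensorProduct.leftModule`).
* `coordMap c j : M ⊗[k] N →ₗ[S] M` — the `S`-linear «coordinate» map `m ⊗ n ↦ (c.repr n j) • m`
  attached to a basis `c` of `N` (the functional `c.coord j` of V₂), `coordMap_tmul`.
* `exists_coordMap_ne_zero` / `exists_linear_ne_zero` — the coordinate maps separate points:
  every non-zero `x ∈ M ⊗[k] N` is detected by an `S`-linear map `M ⊗[k] N →ₗ[S] M`.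
* `iInf_ker_le_ker` — for every `S`-linear `Φ : S₀ →ₗ[S] M ⊗[k] N`, the intersection of the kernels
  of all `S`-linear maps `S₀ →ₗ[S] M` is contained in `ker Φ` (this is «Φ kills S(π₁)»), and
  `exists_factor` — `Φ` factors through the quotient `S₀ ⧸ S(π₁)` (this is «Φ factors through
  S[π₁]»).
The second step (S[π₁] ≅ V₁ ⊗ V₂′ and «a map V₁ ⊗ V₂′ → V₁ ⊗ V₂ is id ⊗ g», MVW Lemma III.3 / III.4)
and the third (the unique coatom, `T5HoweUniqueness`) are the rest of the reading; the first is
pure linear algebra and is what this file checks.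
-/

namespace Summit.Ventures.HodgeRepro2.T5TensorSeparation

open TensorProduct

variable {k S : Type*} [Field k] [Ring S] [Algebra k S]
variable {M : Type*} [AddCommGroup M] [Module k M] [Module S M] [IsScalarTower k S M]
variable {N : Type*} [AddCommGroup N] [Module k N]

/-- The `S`-linear coordinate map `M ⊗[k] N → M`, `m ⊗ n ↦ (c.repr n j) • m`, attached to a basis
`c` of `N` and an index `j`: transport `N ≅ (κ →₀ k)` along `c.repr`, then
`M ⊗[k] (κ →₀ k) ≅ (κ →₀ M)` (`TensorProduct.finsuppScalarRight`), then evaluate at `j`. -/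
noncomputable def coordMap {κ : Type*} [DecidableEq κ] (c : Module.Basis κ k N) (j : κ) :
    M ⊗[k] N →ₗ[S] M :=
  (Finsupp.lapply j : (κ →₀ M) →ₗ[S] M) ∘ₗ (finsuppScalarRight k S M κ).toLinearMap ∘ₗ
    (AlgebraTensorModule.congr (LinearEquiv.refl S M) c.repr).toLinearMap

/-- On pure tensors the coordinate map is the functional `c.coord j` of `N` applied to the right
factor: `coordMap c j (m ⊗ n) = (c.repr n j) • m`. -/
theorem coordMap_tmul {κ : Type*} [DecidableEq κ] (c : Module.Basis κ k N) (j : κ) (m : M) (n : N) :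
    coordMap (S := S) c j (m ⊗ₜ[k] n) = c.repr n j • m := by
  simp [coordMap]

/-- The coordinate maps separate points of `M ⊗[k] N`. -/
theorem exists_coordMap_ne_zero {κ : Type*} [DecidableEq κ] (c : Module.Basis κ k N) {x : M ⊗[k] N}
    (hx : x ≠ 0) : ∃ j : κ, coordMap (S := S) c j x ≠ 0 := by
  by_contra h
  simp only [not_exists, not_not] at h
  apply hx
  have h0 : finsuppScalarRight k S M κ
      ((AlgebraTensorModule.congr (LinearEquiv.refl S M) c.repr) x) = 0 := by
    ext j
    exact h j
  simpa using h0

/-- Every non-zero element of `M ⊗[k] N` is detected by an `S`-linear map to `M`. -/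
theorem exists_linear_ne_zero {x : M ⊗[k] N} (hx : x ≠ 0) :
    ∃ φ : M ⊗[k] N →ₗ[S] M, φ x ≠ 0 := by
  classical
  obtain ⟨j, hj⟩ := exists_coordMap_ne_zero (S := S) (Module.Free.chooseBasis k N) hx
  exact ⟨_, hj⟩

/-- MVW chap. 2 III.5, first step: an `S`-linear map `Φ : S₀ → M ⊗[k] N` kills the intersection
`S(π₁)` of the kernels of all `S`-linear maps `S₀ → M` (compose `Φ` with a coordinate map). -/
theorem iInf_ker_le_ker {S₀ : Type*} [AddCommGroup S₀] [Module S S₀]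
    (Φ : S₀ →ₗ[S] M ⊗[k] N) :
    (⨅ f : S₀ →ₗ[S] M, LinearMap.ker f) ≤ LinearMap.ker Φ := by
  intro s hs
  rw [Submodule.mem_iInf] at hs
  by_contra hΦ
  obtain ⟨φ, hφ⟩ := exists_linear_ne_zero (S := S) (x := Φ s) hΦ
  exact hφ (by simpa using hs (φ ∘ₗ Φ))

/-- Hence `Φ` factors through the quotient `S₀ ⧸ S(π₁)` («Φ factors through S[π₁]»). -/
theorem exists_factor {S₀ : Type*} [AddCommGroup S₀] [Module S S₀]
    (Φ : S₀ →ₗ[S] M ⊗[k] N) :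
    ∃ Φ' : (S₀ ⧸ (⨅ f : S₀ →ₗ[S] M, LinearMap.ker f)) →ₗ[S] M ⊗[k] N,
      Φ' ∘ₗ (⨅ f : S₀ →ₗ[S] M, LinearMap.ker f).mkQ = Φ :=
  ⟨_, Submodule.liftQ_mkQ _ Φ (iInf_ker_le_ker Φ)⟩

end Summit.Ventures.HodgeRepro2.T5TensorSeparation
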